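import Mathlib
import Literature.NumberTheory.EllipticCurves.Smith2016.CongruentNumberGenusDeterminantRowSevenForest
import Literature.NumberTheory.EllipticCurves.Smith2016.CongruentNumberGenusSumSelmerEightFive

/-!
# A nonzero doubly bordered determinant of `M₁` forces `#Sel⁽²⁾(E⁽ⁿ⁾/ℚ) = 8` for `n ≡ 7 (mod 8)` (Smith 2016, Prop. 3.2, rows 7)

A. Smith, *The congruent numbers have positive natural density*, arXiv:1603.08479 [Smith2016CongruentDensity],
Prop. 3.2 (chunk p0011 L58–L66): "`ℒ_x(n)` can only be nonzero if `Sel⁽²⁾(E⁽ⁿ⁾)` has rank exactly three … If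
`n ≡ 7 (8)`, `M₁` has corank at least two, with column space again not containing the final two columns of either
`M_{7a}` or `M_{7b}`."  In the tree's normalisation (Monsky's appendix to [HeathBrown1994SelmerCongruentII]):
`#Sel₂(E⁽ⁿ⁾) = 2^{2+s(n)}`, `s(n) = 2k − rank M`, `rank M = rank M₁ + 1` for `n ≡ 3 (mod 4)`
(`CongruentNumberSmithMatrixSelmer`), and `s(n)` is odd for `n ≡ 7 (8)`.

* `rank_updateCol_le_add_one`, `rank_unitize_le_add_two`, `card_le_rank_add_three_of_det_unitize_unitize_ne_zero` —
  unitizing a row and a column changes the rank by at most `2`; hence a nonzero principal minor of `N` with two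
  indices unitized forces `rank N ≥ card − 3`;
* `rank_smithMatrixOne_eq_rank_bigN` — `rank M₁ = rank N₁` (`N₁ = E M₁ Eᵀ`, `det E = 1`);
* `card_selmerGroup_two_eq_eight_of_det_border_border_ne_zero_seven` — **for `n = p₁⋯p_k ≡ 7 (mod 8)` and ANY
  two border vectors `b, c`: if the doubly bordered determinant `det [[[[M₁, b],[bᵀ,0]], (c;0)],[(c;0)ᵀ, 0]]` is
  nonzero then `#Sel⁽²⁾(E⁽ⁿ⁾/ℚ) = 8`**: some second-order principal minor of `N₁` is nonzero, so
  `rank M₁ = rank N₁ ≥ 2k − 3`, `s(n) = 2k − (rank M₁ + 1) ≤ 2`, and `s(n)` odd gives `s(n) = 1`.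
Used with `b = (t+z; 0)` and `c = (0; t)` (row 7(a)) or `c = (t; 0)` (row 7(b)).
-/

namespace Literature.NumberTheory.EllipticCurves.Smith2016

open _root_.Matrix Finset Literature.LinearAlgebra.Matrix Literature.Combinatorics.Enumerative
open Literature.NumberTheory.EllipticCurves.HeathBrown1994
open Literature.NumberTheory.EllipticCurves.TianYuanZhang2017
open Literature.NumberTheory.EllipticCurves.HeathBrown1994.Families (legendreMatrix_apply_of_ne legendreMatrix_apply_self)
open Literature.NumberTheory.EllipticCurves.MonskySelmerParity

section Rank

variable {m : Type*} [Fintype m] [DecidableEq m] {K : Type*} [Field K]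

omit [Fintype m] in
/-- A column replacement is a rank-one update: `A.updateCol j c = A + (c − A·e_j) e_jᵀ`.
[cite: HornJohnson2013, §0.4.5 (rank of a rank-one perturbation)] -/
theorem updateCol_eq_add_vecMulVec (A : Matrix m m K) (j : m) (c : m → K) :
    A.updateCol j c = A + vecMulVec (c - fun i => A i j) (Pi.single j 1) := by
  ext a b
  rw [updateCol_apply, Matrix.add_apply, vecMulVec_apply, Pi.single_apply]
  by_cases h : b = j
  · subst h; simp
  · simp [h]

/-- Replacing one column changes the rank by at most one. [cite: HornJohnson2013, §0.4.5] -/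
theorem rank_updateCol_le_add_one (A : Matrix m m K) (j : m) (c : m → K) :
    (A.updateCol j c).rank ≤ A.rank + 1 := by
  rw [updateCol_eq_add_vecMulVec]
  have h1 := Literature.Barriers.ValiantsHypothesis.AKV.rank_add_le' A (vecMulVec (c - fun i => A i j) (Pi.single j 1))
  have h2 := rank_vecMulVec_le (c - fun i => A i j) (Pi.single j (1 : K))
  omega

/-- Replacing one row changes the rank by at most one. [cite: HornJohnson2013, §0.4.5] -/
theorem rank_updateRow_le_add_one (A : Matrix m m K) (j : m) (r : m → K) :
    (A.updateRow j r).rank ≤ A.rank + 1 := by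
  rw [updateRow_eq_add_vecMulVec]
  have h1 := Literature.Barriers.ValiantsHypothesis.AKV.rank_add_le' A (vecMulVec (Pi.single j 1) (r - A j))
  have h2 := rank_vecMulVec_le (Pi.single j (1 : K)) (r - A j)
  omega

/-- Unitizing a row and a column changes the rank by at most two. [cite: HornJohnson2013, §0.4.5] -/
theorem rank_unitize_le_add_two (A : Matrix m m K) (v : m) : (unitize A v).rank ≤ A.rank + 2 := by
  unfold unitize
  have h1 := rank_updateCol_le_add_one (A.updateRow v (Pi.single v 1)) v (Pi.single v 1)
  have h2 := rank_updateRow_le_add_one A v (Pi.single v 1)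
  omega

/-- **A nonzero principal minor with two indices deleted forces `rank ≥ card − 3`** (over `𝔽₂`):
`det (unitize (unitize N α) β) ≠ 0 ⟹ card ≤ rank N + 3` (the minor is the diagonal cofactor of `unitize N α` at `β`,
so `rank (unitize N α) ≥ card − 1`, and `rank (unitize N α) ≤ rank N + 2`).
[cite: HornJohnson2013, §0.8.2 and §0.4.5] [cite: Smith2016CongruentDensity, Prop. 3.2 ("M₁ has corank at least two")] -/
theorem card_le_rank_add_three_of_det_unitize_unitize_ne_zero (N : Matrix m m (ZMod 2)) {α β : m}
    (h : (unitize (unitize N α) β).det ≠ 0) : Fintype.card m ≤ N.rank + 3 := by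
  rw [← adjugate_apply_self_eq_det_unitize] at h
  have h1 := card_le_rank_add_one_of_adjugate_ne_zero (unitize N α) h
  have h2 := rank_unitize_le_add_two N α
  omega

end Rank

variable {k : ℕ} (p : Fin k → ℕ)

section Selmer

/-- **`rank M₁ = rank N₁`**: Smith's `M₁ = [[A + Aᵀ, Aᵀ],[A, D_z]]` and the doubled forest matrix
`N₁ = [[D_z, (A+D_z)ᵀ],[A + D_z, D_z]] = E M₁ Eᵀ` (`E = [[I,I],[0,I]]`, `det E = 1`) have the same rank.
[cite: Smith2016CongruentDensity, §2 (the matrix M₁)] [cite: HornJohnson2013, §0.4.6 (rank is invariant under equivalence)] -/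
theorem rank_smithMatrixOne_eq_rank_bigN :
    (fromBlocks (legendreMatrix p + (legendreMatrix p)ᵀ) (legendreMatrix p)ᵀ (legendreMatrix p) (legendreDiagonal p 2)).rank =
      (bigN (fun i j => legendreMatrix p i j) univ (fun i => addLegendreSym 2 (p i))
        (fun i => addLegendreSym 2 (p i)) (fun i => addLegendreSym 2 (p i))).rank := by
  have hD2 : legendreDiagonal p 2 = diagonal fun i => addLegendreSym 2 (p i) := rfl
  have hconj := conj_fromBlocks_add_transpose (legendreMatrix p) (legendreDiagonal p 2)
  rw [bigN_univ_eq_fromBlocks _ (legendreMatrix_apply_self p), transpose_add, diagonal_transpose, ← hD2, ← hconj,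
    Matrix.mul_assoc, Matrix.rank_mul_eq_right_of_isUnit_det _ _ (by rw [det_fromBlocks_zero₂₁, det_one, mul_one]; exact isUnit_one),
    Matrix.rank_mul_eq_left_of_isUnit_det _ _ (by rw [det_fromBlocks_zero₁₂, det_one, mul_one]; exact isUnit_one)]

/-- **A nonzero doubly bordered determinant of `M₁` gives `#Sel⁽²⁾(E⁽ⁿ⁾/ℚ) = 8` for `n = p₁⋯p_k ≡ 7 (mod 8)`**, for
ANY border vectors `b, c` on `[k] ⊕ [k]`: transported by `E`, the determinant is a weighted sum of second-order
principal minors of `N₁`, one of which is nonzero; so `rank M₁ = rank N₁ ≥ 2k − 3`, Monsky's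
`s(n) = 2k − rank M = 2k − rank M₁ − 1 ≤ 2`, and `s(n)` is odd, whence `s(n) = 1` and `#Sel₂ = 2³`.
[cite: Smith2016CongruentDensity, Prop. 3.2 (chunk p0011 L58–L66)] [cite: HeathBrown1994SelmerCongruentII, Appendix (Monsky), Theorem (typescript p. 38 L5–L7) and p. 40 L1–L24] -/
theorem card_selmerGroup_two_eq_eight_of_det_border_border_ne_zero_seven (hp : ∀ i, (p i).Prime)
    (hodd : ∀ i, Odd (p i)) (hinj : Function.Injective p) (h8 : (∏ i, p i) % 8 = 7)
    (b c : Fin k ⊕ Fin k → ZMod 2)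
    (hdet : (fromBlocks (fromBlocks (fromBlocks (legendreMatrix p + (legendreMatrix p)ᵀ) (legendreMatrix p)ᵀ
          (legendreMatrix p) (legendreDiagonal p 2)) (replicateCol Unit b) (replicateRow Unit b) 0)
        (replicateCol Unit (Sum.elim c 0)) (replicateRow Unit (Sum.elim c 0)) 0).det ≠ 0) :
    Nat.card ((congruentNumberCurve (∏ i, p i)).selmerGroup 2) = 8 := by
  have hp2 := ne_two_of_odd p hodd
  set N₁ := bigN (fun i j => legendreMatrix p i j) univ (fun i => addLegendreSym 2 (p i))
    (fun i => addLegendreSym 2 (p i)) (fun i => addLegendreSym 2 (p i)) with hN₁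
  have hD2 : legendreDiagonal p 2 = diagonal fun i => addLegendreSym 2 (p i) := rfl
  have hNeq : fromBlocks (legendreDiagonal p 2) ((legendreMatrix p)ᵀ + legendreDiagonal p 2)
      (legendreMatrix p + legendreDiagonal p 2) (legendreDiagonal p 2) = N₁ := by
    rw [hN₁, bigN_univ_eq_fromBlocks _ (legendreMatrix_apply_self p), hD2, transpose_add, diagonal_transpose]
  rw [det_border_border_transport, hNeq, det_fromBlocks_border_border (by rw [hN₁, bigN_transpose])] at hdet
  -- some second-order principal minor of `N₁` is nonzero
  have hex : ∃ α β, (unitize (unitize N₁ α) β).det ≠ 0 := by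
    by_contra hall
    push Not at hall
    apply hdet
    refine sum_eq_zero fun α _ => ?_
    rw [sum_eq_zero fun β _ => by rw [hall α β, mul_zero], mul_zero]
  obtain ⟨α, β, hαβ⟩ := hex
  have hrank := card_le_rank_add_three_of_det_unitize_unitize_ne_zero N₁ hαβ
  rw [Fintype.card_sum, Fintype.card_fin, hN₁, ← rank_smithMatrixOne_eq_rank_bigN p] at hrank
  have hM := rank_monskyMatrixOdd_eq_rank_smithMatrixOne_add p hp hodd hinj
  rw [if_neg (by omega)] at hM
  have hsodd : Odd (monskySelmerRankOdd p) :=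
    (odd_monskySelmerRankOdd_iff p hp hp2 hinj).mpr (Or.inr h8)
  have hs1 : monskySelmerRankOdd p = 1 := by
    have hle : monskySelmerRankOdd p ≤ 2 := by rw [monskySelmerRankOdd, hM]; omega
    rcases hsodd with ⟨m, hm⟩
    omega
  rw [monsky_card_selmerGroup_two_odd_holds k p hp hodd hinj, hs1]
  norm_num

end Selmer

end Literature.NumberTheory.EllipticCurves.Smith2016
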